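import Mathlib.Analysis.Calculus.InverseFunctionTheorem.FDeriv
import Mathlib.Analysis.Calculus.FDeriv.Mul
import Mathlib.Analysis.Calculus.FDeriv.Add
import Mathlib.Analysis.Calculus.FDeriv.Prod
import Mathlib.Analysis.Analytic.Polynomial
import Mathlib.Analysis.Analytic.Uniqueness
import Mathlib.Analysis.Normed.Module.Convex
import Literature.Computability.AlgebraicComplexity.AsymptoticRankZariskiClosedProofs
import Literature.Computability.AlgebraicComplexity.AsymptoticRankMultiples
import Summits.MatrixMultiplication.MatrixMultiplication.Theorems.SoloInformedCwTwoDoor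
import Summits.MatrixMultiplication.MatrixMultiplication.Theorems.SoloInformedCwTwoSpeedup

/-!
# `T_{cw,2} ⊕ ⟨1⟩` is universal for `ℂ³ ⊗ ℂ³ ⊗ ℂ³`: every `3 × 3 × 3` tensor has asymptotic rank `≤ R̃(T_{cw,2}) + 1`

Solo seat `solo-MatrixMultiplication-informed` (gen 21). Let `U = T_{cw,2} ⊕ ⟨1⟩ ∈ ℂ⁴ ⊗ ℂ⁴ ⊗ ℂ⁴`
(`univTensor`, the small Coppersmith–Winograd tensor `cwTensor ℂ 2` direct-summed with the
`1 × 1 × 1` unit tensor). **Theorem V (universality).** The set of restrictions of `U` to the format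
`3 × 3 × 3`, i.e. the image of the cubic polynomial map
`Ψ : (A, B, C) ↦ (A ⊗ B ⊗ C) · U`, `A, B, C : ℂ⁴ → ℂ³` (`restrictMap`), is dense in
`ℂ³ ⊗ ℂ³ ⊗ ℂ³`; consequently (`asymptoticRank_le_univTensor`, `asymptoticRank_le_cwTwo_add_one`)

  `R̃(T) ≤ R̃(T_{cw,2} ⊕ ⟨1⟩) ≤ R̃(T_{cw,2}) + 1`   for EVERY `T ∈ ℂ³ ⊗ ℂ³ ⊗ ℂ³`,

so every `3 × 3 × 3` tensor is a degeneration of `T_{cw,2} ⊕ ⟨1⟩` as far as the asymptotic rank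
(indeed every Zariski-continuous degeneration-monotone) is concerned. In exponent form
`σ(3) := max_T log₃ R̃(T) ≤ log₃ (R̃(T_{cw,2}) + 1)`: with the Alman–Li value `R̃(T_{cw,2}) ≤ 3.9235`
(named fact `AlmanLi2026_iteratedSpeedup_cw`, reproduced in `SoloInformedCwTwoSpeedup`) every
`3 × 3 × 3` tensor has `R̃ ≤ 4.9235 < 5 = ` the generic border rank
(`asymptoticRank_le_of_almanLi`), and door D1 `R̃(T_{cw,2}) = 3` would give `R̃ ≤ 4` throughout
`ℂ³ ⊗ ℂ³ ⊗ ℂ³` (`asymptoticRank_le_four_of_door`). Conversely the extended asymptotic rank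
conjecture at `d = 3` (`∀ T, R̃(T) ≤ 3`, "`σ(3) = 1`") contains door D1 and hence gives `ω = 2`
(`matrixMultiplication_of_sigma_three`): on `ℂ³ ⊗ ℂ³ ⊗ ℂ³` the "rising-sea" door and door D1
differ by at most one unit of asymptotic rank,
`R̃(T_{cw,2}) ≤ max_{3×3×3} R̃ ≤ R̃(T_{cw,2}) + 1` (`cwTwo_sandwich`).

## Proof

* `R̃(U) ≤ R̃(T_{cw,2}) + R̃(⟨1⟩) ≤ R̃(T_{cw,2}) + 1`: Strassen duality (proved in the tree,
  `strassen_duality_asymptoticRank_holds`) makes `R̃` sub-additive under `⊕`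
  (`asymptoticRank_directSumTensor_le`).
* Every `Ψ(M)` is a restriction of `U` by definition, so `R̃(Ψ M) ≤ R̃(U)`.
* SUBMERSION CERTIFICATE. `Ψ` is a polynomial map `ℂ³⁶ → ℂ²⁷`; its (strict Fréchet) derivative at
  `M` is `V ↦ jacApply U M V` (`hasStrictFDerivAt_restrictMap`, product rule). At the integer base
  point `M₀ = ([I | u₀], [I | u₁], [I | u₂])`, `u₀ = (0,1,0)`, `u₁ = (-1,0,-1)`, `u₂ = (-1,-1,1)`
  (`basePointℤ`) the derivative is ONTO: the file lists `27` integer directions `W_{ijk}` (entries in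
  `{-2,…,2}`) with `jacApply U M₀ W_{ijk} = e_i ⊗ e_j ⊗ e_k`, checked by `decide` over `ℤ`
  (`cert`) and transported to `ℂ`.
* By the inverse function theorem (`HasStrictFDerivAt.map_nhds_eq_of_surj`) the image of `Ψ` is a
  neighbourhood of `Ψ(M₀)`. A polynomial vanishing on the image vanishes near `Ψ(M₀)`, hence
  everywhere (identity theorem for analytic functions on the connected space `ℂ²⁷`).
* CHNVZ (Christandl–Hoeberechts–Nieuwboer–Vrana–Zuiddam 2025, Thm 1.2, PROVED in the tree as
  `chnvz_zariskiClosed_asymptoticRank_le_holds`): the sublevel set `{R̃ ≤ R̃(U)}` is Zariski closed;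
  it contains the image of `Ψ`, hence every `T`.

Informal remarks. (i) `+1` is optimal for this mechanism under door D1: a single tensor `X` whose
restrictions are dense in `ℂ³ ⊗ ℂ³ ⊗ ℂ³` must live in a format with a leg `≥ 4` (orbits in
`ℂ³ ⊗ ℂ³ ⊗ ℂ³` have codimension `≥ 2`), and `R̃(T_{cw,2} ⊕ Z) = max_F (F(T_{cw,2}) + F(Z)) ≥
R̃(T_{cw,2}) + 1` for every non-zero `Z`; exact Jacobian ranks (seat computation): `T_{cw,2} ⊕ ⟨1⟩`
and `T_{cw,3} ⊕ ⟨1⟩` are dominant (rank `27`), `T_{skewcw,2} ⊕ ⟨1⟩` (rank `24`), `T_{CW,1} ⊕ ⟨1⟩`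
(rank `26`) and `T_{cw,3}` restricted to `3 × 3 × 3` (rank `25`) are not. (ii) In print the best
universal bound at `d = 3` is the generic border rank `5` (Kaski–Michałek 2025 ask for `σ(3)`;
Lee 2026 finds no improvement at `d = 3` from higher secant varieties); `4.9235` appears to be the
first bound below `5`, and it is tied to door D1 up to one unit.

[cite: ChristandlHoeberechtsNieuwboerVranaZuiddam2025, Theorem 1.2]
[cite: ChristandlVranaZuiddam2023, Prop. 1.6]
[cite: CoppersmithWinograd1990, §6]
[cite: AlmanLi2026, Theorem 1.3]
-/

open scoped BigOperators Topology
open Filter Set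

namespace Summit.MatrixMultiplication.MatrixMultiplication.Theorems.CwTwoPlusUnit

open Literature.Computability.AlgebraicComplexity
open Literature.Barriers.MatrixMultiplication (asymptoticRank_le_of_polyDegeneratesTo)

noncomputable section

/-! ## The universal tensor `U = T_{cw,2} ⊕ ⟨1⟩` and its asymptotic rank -/

/-- Index type of `ℂ³ ⊕ ℂ¹ = ℂ⁴`. -/
abbrev Idx : Type := Fin 3 ⊕ Fin 1

/-- `U = T_{cw,2} ⊕ ⟨1⟩ ∈ ℂ⁴ ⊗ ℂ⁴ ⊗ ℂ⁴`. -/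
def univTensor : Idx → Idx → Idx → ℂ := directSumTensor (cwTensor ℂ 2) (unitTensor ℂ 1)

/-- **`R̃` is sub-additive under `⊕`** (over `ℂ`; from Strassen duality, proved in the tree: every
universal spectral point is additive and bounded by `R̃`). [cite: ChristandlVranaZuiddam2023, Prop. 1.6] -/
theorem asymptoticRank_directSumTensor_le {ι κ μ ι' κ' μ' : Type} [Fintype ι] [Fintype κ]
    [Fintype μ] [Fintype ι'] [Fintype κ'] [Fintype μ'] (s : ι → κ → μ → ℂ)
    (t : ι' → κ' → μ' → ℂ) :
    asymptoticRank (directSumTensor s t) ≤ asymptoticRank s + asymptoticRank t :=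
  strassen_duality_asymptoticRank.asymptoticRank_le (strassen_duality_asymptoticRank_holds ℂ) _
    fun F hF => by
    rw [hF.map_directSum]
    exact add_le_add ((strassen_duality_asymptoticRank_holds ℂ s).1 F hF)
      ((strassen_duality_asymptoticRank_holds ℂ t).1 F hF)

/-- `R̃(T_{cw,2} ⊕ ⟨1⟩) ≤ R̃(T_{cw,2}) + 1`. -/
theorem asymptoticRank_univTensor_le :
    asymptoticRank univTensor ≤ asymptoticRank (cwTensor ℂ 2) + 1 :=
  (asymptoticRank_directSumTensor_le _ _).trans
    (by simpa using add_le_add_left (asymptoticRank_unitTensor_le ℂ 1) (asymptoticRank (cwTensor ℂ 2)))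

/-! ## The restriction map `Ψ` -/

/-- Parameter space `ℂ³⁶`: three `3 × 4` matrices `M 0 = A`, `M 1 = B`, `M 2 = C`. -/
abbrev Param : Type := Fin 3 → Fin 3 → Idx → ℂ

/-- `Ψ(A, B, C) = (A ⊗ B ⊗ C) · U ∈ ℂ³ ⊗ ℂ³ ⊗ ℂ³`. -/
def restrictMap (M : Param) : Fin 3 → Fin 3 → Fin 3 → ℂ :=
  fun i j k => ∑ a, ∑ b, ∑ c, M 0 i a * M 1 j b * M 2 k c * univTensor a b c

/-- Every `Ψ(M)` is a restriction of `U` (by definition). -/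
theorem univTensor_restrictsTo_restrictMap (M : Param) :
    TensorRestrictsTo univTensor (restrictMap M) :=
  ⟨M 0, M 1, M 2, fun _ _ _ => rfl⟩

/-- Hence `R̃(Ψ M) ≤ R̃(U)`. -/
theorem asymptoticRank_restrictMap_le (M : Param) :
    asymptoticRank (restrictMap M) ≤ asymptoticRank univTensor :=
  asymptoticRank_le_of_polyDegeneratesTo (univTensor_restrictsTo_restrictMap M).polyDegeneratesTo

/-! ## The derivative of `Ψ` -/

/-- The Jacobian of the restriction map, applied to a direction `V` (polarisation of the trilinear
map), over any commutative ring. -/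
def jacApply {R : Type} [CommRing R] (X : Idx → Idx → Idx → R) (M V : Fin 3 → Fin 3 → Idx → R) :
    Fin 3 → Fin 3 → Fin 3 → R :=
  fun i j k => ∑ a, ∑ b, ∑ c, X a b c *
    (V 0 i a * M 1 j b * M 2 k c + M 0 i a * V 1 j b * M 2 k c + M 0 i a * M 1 j b * V 2 k c)

/-- The coordinate `M ↦ M l i a` as a continuous linear form on `Param`. -/
def coord (l i : Fin 3) (a : Idx) : Param →L[ℂ] ℂ :=
  (ContinuousLinearMap.proj a).comp ((ContinuousLinearMap.proj i).comp
    (ContinuousLinearMap.proj (R := ℂ) (φ := fun _ : Fin 3 => Fin 3 → Idx → ℂ) l))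

/-- `coord l i a M = M l i a`. -/
@[simp] theorem coord_apply (l i : Fin 3) (a : Idx) (M : Param) : coord l i a M = M l i a := rfl

/-- A coordinate is its own strict derivative. -/
theorem hasStrictFDerivAt_coord (l i : Fin 3) (a : Idx) (M₀ : Param) :
    HasStrictFDerivAt (fun M : Param => M l i a) (coord l i a) M₀ :=
  (coord l i a).hasStrictFDerivAt

/-- The derivative of one cubic term of `Ψ`. -/
theorem hasStrictFDerivAt_term (M₀ : Param) (i j k : Fin 3) (a b c : Idx) :
    HasStrictFDerivAt (fun M : Param => M 0 i a * M 1 j b * M 2 k c * univTensor a b c)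
      (univTensor a b c • ((M₀ 0 i a * M₀ 1 j b) • coord 2 k c +
        M₀ 2 k c • (M₀ 0 i a • coord 1 j b + M₀ 1 j b • coord 0 i a))) M₀ :=
  (((hasStrictFDerivAt_coord 0 i a M₀).mul (hasStrictFDerivAt_coord 1 j b M₀)).mul
    (hasStrictFDerivAt_coord 2 k c M₀)).mul_const (univTensor a b c)

/-- The derivative of the entry `Ψ(·)_{ijk}` at `M₀`, as a continuous linear form. -/
def entryDeriv (M₀ : Param) (i j k : Fin 3) : Param →L[ℂ] ℂ :=
  ∑ a, ∑ b, ∑ c, univTensor a b c • ((M₀ 0 i a * M₀ 1 j b) • coord 2 k c +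
    M₀ 2 k c • (M₀ 0 i a • coord 1 j b + M₀ 1 j b • coord 0 i a))

/-- The entry `Ψ(·)_{ijk}` is strictly differentiable with derivative `entryDeriv`. -/
theorem hasStrictFDerivAt_entry (M₀ : Param) (i j k : Fin 3) :
    HasStrictFDerivAt (fun M : Param => restrictMap M i j k) (entryDeriv M₀ i j k) M₀ := by
  unfold restrictMap entryDeriv
  exact HasStrictFDerivAt.fun_sum fun a _ => HasStrictFDerivAt.fun_sum fun b _ =>
    HasStrictFDerivAt.fun_sum fun c _ => hasStrictFDerivAt_term M₀ i j k a b c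

/-- `entryDeriv` evaluates to the `(i,j,k)` entry of `jacApply U M₀`. -/
theorem entryDeriv_apply (M₀ V : Param) (i j k : Fin 3) :
    entryDeriv M₀ i j k V = jacApply univTensor M₀ V i j k := by
  simp only [entryDeriv, jacApply, FunLike.coe_sum, Finset.sum_apply, FunLike.coe_smul,
    Pi.smul_apply, _root_.add_apply, _root_.smul_apply, coord_apply, smul_eq_mul]
  refine Finset.sum_congr rfl fun a _ => Finset.sum_congr rfl fun b _ =>
    Finset.sum_congr rfl fun c _ => ?_
  ring

/-- The derivative of `Ψ` at `M₀` as a continuous linear map `ℂ³⁶ → ℂ²⁷`. -/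
def totalDeriv (M₀ : Param) : Param →L[ℂ] (Fin 3 → Fin 3 → Fin 3 → ℂ) :=
  ContinuousLinearMap.pi fun i => ContinuousLinearMap.pi fun j =>
    ContinuousLinearMap.pi fun k => entryDeriv M₀ i j k

/-- `totalDeriv M₀ V = jacApply U M₀ V`. -/
theorem totalDeriv_apply (M₀ V : Param) : totalDeriv M₀ V = jacApply univTensor M₀ V := by
  funext i j k
  simp [totalDeriv, entryDeriv_apply]

/-- **`Ψ` is strictly differentiable with derivative `V ↦ jacApply U M₀ V`.** -/
theorem hasStrictFDerivAt_restrictMap (M₀ : Param) :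
    HasStrictFDerivAt restrictMap (totalDeriv M₀) M₀ := by
  have h3 : ∀ i j : Fin 3, HasStrictFDerivAt (fun (M : Param) (k : Fin 3) => restrictMap M i j k)
      (ContinuousLinearMap.pi fun k => entryDeriv M₀ i j k) M₀ :=
    fun i j => hasStrictFDerivAt_pi.2 fun k => hasStrictFDerivAt_entry M₀ i j k
  have h2 : ∀ i : Fin 3, HasStrictFDerivAt (fun (M : Param) (j : Fin 3) => fun k => restrictMap M i j k)
      (ContinuousLinearMap.pi fun j => ContinuousLinearMap.pi fun k => entryDeriv M₀ i j k) M₀ :=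
    fun i => hasStrictFDerivAt_pi.2 fun j => h3 i j
  exact hasStrictFDerivAt_pi.2 fun i => h2 i

/-! ## The integer certificate: the derivative at `M₀` is onto -/

/-- `U` with integer entries. -/
def univTensorℤ : Idx → Idx → Idx → ℤ
  | Sum.inl a, Sum.inl b, Sum.inl c =>
      if (a = 0 ∧ b = c ∧ b ≠ 0) ∨ (b = 0 ∧ a = c ∧ a ≠ 0) ∨ (c = 0 ∧ a = b ∧ a ≠ 0) then 1 else 0
  | Sum.inr _, Sum.inr _, Sum.inr _ => 1
  | _, _, _ => 0

/-- `U` is the cast of its integer model. -/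
theorem univTensor_eq_cast : univTensor = fun a b c => (univTensorℤ a b c : ℂ) := by
  funext a b c
  rcases a with a | a <;> rcases b with b | b <;> rcases c with c | c <;>
    (try obtain rfl : a = 0 := Fin.fin_one_eq_zero a) <;>
    (try obtain rfl : b = 0 := Fin.fin_one_eq_zero b) <;>
    (try obtain rfl : c = 0 := Fin.fin_one_eq_zero c) <;>
    simp [univTensor, univTensorℤ, directSumTensor, cwTensor_apply, unitTensor_apply, Int.cast_ite]

/-- The base point `M₀ = ([I | u₀], [I | u₁], [I | u₂])`, `u₀ = (0,1,0)`, `u₁ = (-1,0,-1)`,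
`u₂ = (-1,-1,1)`. -/
def basePointℤ : Fin 3 → Fin 3 → Idx → ℤ
  | _, i, Sum.inl a => if i = a then 1 else 0
  | l, i, Sum.inr _ => ![![0, 1, 0], ![-1, 0, -1], ![-1, -1, 1]] l i

/-- Table of the `ℂ³`-parts of the `27` certificate directions `W_{ijk}` (indices
`i j k l i' a`). -/
def certDirL : Fin 3 → Fin 3 → Fin 3 → Fin 3 → Fin 3 → Fin 3 → ℤ :=
  ![![![![![![0, 0, 0], ![0, 1, -1], ![0, 0, 0]], ![![0, -1, 1], ![0, 0, 0], ![0, -1, 1]], ![![-1, 0, -1], ![0, 0, 0], ![0, 0, 0]]], ![![![0, 0, 0], ![1, 1, 1], ![0, 0, 0]], ![![0, 1, 0], ![0, 0, 0], ![1, 0, 0]], ![![0, 0, 0], ![0, 0, 0], ![-1, 0, 0]]], ![![![0, 0, 0], ![1, 1, 2], ![0, 0, 0]], ![![-1, 0, 1], ![0, 0, 0], ![1, -1, 0]], ![![1, 0, 0], ![1, 0, 1], ![-2, 0, 0]]]], ![![![![0, 0, 0], ![1, 1, 1], ![0, 0, 0]], ![![0, 0, 0], ![0, 0, 0], ![1,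 0, 0]], ![![0, 1, 0], ![0, 0, 0], ![-1, 0, 0]]], ![![![1, 0, 0], ![0, -1, 1], ![0, 0, 0]], ![![0, 0, 0], ![0, 0, 0], ![0, 0, -1]], ![![1, 0, 0], ![0, 0, 0], ![0, 0, 0]]], ![![![0, 0, 0], ![1, 1, 0], ![0, 0, 0]], ![![0, 0, 0], ![0, 0, 0], ![1, 0, 0]], ![![0, 0, 0], ![0, 0, 0], ![-1, 1, 0]]]], ![![![![0, 0, 0], ![1, 1, 2], ![0, 0, 0]], ![![-1, 0, 0], ![0, 0, 0], ![1, -1, 0]], ![![1, 0, 1], ![1, 0, 1], ![-2, 0, 0]]], ![![![0, 0, 0], ![-1, -1, -1], ![0, 0, 0]], ![![0, 0, 0], ![0, 0, 0], ![-1, 1, 0]], ![![0, 0, 0], ![0, 0, 0], ![1, 0, 0]]], ![![![0, 0, 0], ![0, 1, -1], ![0, 0, 0]], ![![0, 0, 0], ![0, 0, 0], ![0, 0, 1]], ![![-1, 0, 0], ![0, 0, 0], ![0, 0, 0]]]]], ![![![![![0, 0, 0], ![-1, -1, -1], ![0, 0, 0]], ![![0, 0, 0], ![0, 0, 0], ![-1,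 0, 0]], ![![0, 0, 0], ![0, 0, 0], ![1, 0, 0]]], ![![![0, 0, 0], ![0, 0, 1], ![0, 0, 0]], ![![0, 0, 0], ![0, 0, 0], ![0, 0, 0]], ![![0, 0, 0], ![0, 0, 0], ![0, 0, 0]]], ![![![0, 0, 0], ![-1, -1, 0], ![0, 0, 0]], ![![0, 0, 0], ![0, 0, 0], ![-1, 0, 0]], ![![0, 0, 0], ![0, 0, 0], ![1, 0, 0]]]], ![![![![0, 0, 0], ![0, 1, -1], ![0, 0, 0]], ![![0, 0, 0], ![0, 0, 0], ![0, 0, 0]], ![![0, 0, 0], ![0, 0, 0], ![0, 0, 0]]], ![![![0, 0, 0], ![0, -1, 0], ![0, 0, 0]], ![![0, 0, 0], ![0, 0, 0], ![-1, 0, 0]], ![![0, 0, 0], ![0, 0, 0], ![1, 0, 0]]], ![![![0, 0, 0], ![0, 0, -1], ![0, 0, 0]], ![![0, 0, 0], ![0, 0, 0], ![-1, 0, 0]], ![![0, 0, 0], ![0, 0, 0], ![1, 0, 0]]]], ![![![![0, 0, 0], ![1, 1, 1], ![0, 0, 0]], ![![0, 0, 0], ![0, 0, 0], ![1, 0, 0]],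 ![![0, 0, 0], ![0, 0, 0], ![-1, 0, 0]]], ![![![0, 0, 0], ![0, 0, -1], ![0, 0, 0]], ![![0, 0, 0], ![0, 0, 0], ![0, 0, 0]], ![![0, 0, 0], ![0, 0, 0], ![0, 0, 0]]], ![![![0, 0, 0], ![1, 1, 0], ![0, 0, 0]], ![![0, 0, 0], ![0, 0, 0], ![1, 0, 0]], ![![0, 0, 0], ![0, 0, 0], ![-1, 0, 0]]]]], ![![![![![0, 0, 0], ![-1, -1, -2], ![0, 0, 0]], ![![1, 0, 0], ![0, 0, 0], ![-1, 1, 0]], ![![-1, 0, 0], ![-1, 0, -1], ![2, 0, 0]]], ![![![0, 0, 0], ![1, 1, 1], ![0, 0, 0]], ![![0, 0, 0], ![0, 0, 0], ![1, -1, 0]], ![![0, 0, 0], ![0, 0, 1], ![-1, 0, 0]]], ![![![0, 0, 0], ![0, 0, -1], ![0, 0, 0]], ![![1, 0, 0], ![0, 0, 0], ![0, 0, 0]], ![![0, 0, 0], ![0, 0, 0], ![0, 0, 0]]]], ![![![![0, 0, 0], ![-1, -1, 0], ![0, 0, 0]], ![![0, 0, 0], ![0, 0, 1], ![-1, 0,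 0]], ![![0, 0, 0], ![0, 0, 0], ![1, -1, 0]]], ![![![0, 0, 0], ![0, 0, -1], ![1, 0, 0]], ![![0, 0, 0], ![0, 0, 0], ![-1, 0, 0]], ![![0, 0, 0], ![0, 0, 0], ![0, 0, 0]]], ![![![0, 0, 0], ![0, 1, 0], ![0, 0, 0]], ![![0, 0, 0], ![1, 0, 0], ![1, 0, 0]], ![![0, 0, 0], ![0, 0, 0], ![-1, 0, 0]]]], ![![![![0, 0, 0], ![0, -1, 1], ![0, 0, 0]], ![![0, 0, 0], ![0, 0, 0], ![0, 0, 0]], ![![1, 0, 0], ![0, 0, 0], ![0, 0, 0]]], ![![![0, 0, 0], ![0, 1, 0], ![0, 0, 0]], ![![0, 0, 0], ![0, 0, 0], ![1, 0, 0]], ![![0, 0, 0], ![1, 0, 0], ![-1, 0, 0]]], ![![![0, 0, 0], ![0, 0, 1], ![0, 0, 0]], ![![0, 0, 0], ![0, 0, 0], ![1, 0, 0]], ![![0, 0, 0], ![0, 0, 0], ![0, 0, 0]]]]]]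

/-- Table of the `⟨1⟩`-parts of the `27` certificate directions `W_{ijk}` (indices `i j k l i'`). -/
def certDirR : Fin 3 → Fin 3 → Fin 3 → Fin 3 → Fin 3 → ℤ :=
  ![![![![![1, 1, 0], ![0, 0, -1], ![0, 2, -2]], ![![0, -1, 0], ![0, 1, 0], ![0, 0, 2]], ![![0, 0, -1], ![0, 2, 1], ![0, 0, 2]]], ![![![0, -1, 0], ![0, 1, 0], ![0, 0, 2]], ![![0, 0, 0], ![0, 0, 1], ![0, -1, 1]], ![![0, 0, 0], ![0, 1, 0], ![0, 1, 1]]], ![![![0, 0, -1], ![0, 2, 1], ![0, 0, 2]], ![![0, 0, 0], ![0, -1, 0], ![0, -1, -1]], ![![0, 0, 0], ![0, 0, -1], ![0, 1, -1]]]], ![![![![0, 1, 0], ![0, -1, 0], ![0, 0, -2]], ![![0, 0, 0], ![0, 0, 1], ![0, -1, 1]], ![![0, 0, 0], ![0, -1, 0], ![0, -1, -1]]], ![![![0, 0, 0], ![0, 0, -1], ![0, 1, -1]], ![![0, 0, 0], ![0, -1, 0], ![0, -1, 0]], ![![0, 0, 0], ![0, 0, -1], ![0, 0, -1]]], ![![![0,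 0, 0], ![0, 1, 0], ![0, 1, 1]], ![![0, 0, 0], ![0, 0, -1], ![0, 0, -1]], ![![0, 0, 0], ![0, 1, 0], ![0, 1, 0]]]], ![![![![0, 0, 1], ![0, -2, -1], ![0, 0, -2]], ![![0, 0, 0], ![0, 1, 0], ![0, 1, 1]], ![![0, 0, 0], ![0, 0, -1], ![0, 1, -1]]], ![![![0, 0, 0], ![0, -1, 0], ![0, -1, -1]], ![![0, 0, 0], ![0, 0, -1], ![0, 0, -1]], ![![0, 0, 0], ![0, 1, 0], ![0, 1, 0]]], ![![![0, 0, 0], ![0, 0, 1], ![0, -1, 1]], ![![0, 0, 0], ![0, 1, 0], ![0, 1, 0]], ![![0, 0, 0], ![0, 0, 1], ![0, 0, 1]]]]]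

/-- The certificate direction `W_{ijk} ∈ ℤ³⁶`. -/
def certDir (i j k : Fin 3) : Fin 3 → Fin 3 → Idx → ℤ
  | l, i', Sum.inl a => certDirL i j k l i' a
  | l, i', Sum.inr _ => certDirR i j k l i'

/-- **Kernel certificate**: `jacApply U M₀ W_{ijk} = e_i ⊗ e_j ⊗ e_k` for all `27` triples. -/
theorem cert : ∀ i j k : Fin 3, jacApply univTensorℤ basePointℤ (certDir i j k) =
    fun i' j' k' => if i' = i ∧ j' = j ∧ k' = k then 1 else 0 := by
  decide +kernel

/-- Integer parameters as complex ones. -/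
def castParam (M : Fin 3 → Fin 3 → Idx → ℤ) : Param := fun l i a => (M l i a : ℂ)

/-- `jacApply` commutes with the cast `ℤ → ℂ`. -/
theorem jacApply_cast (X : Idx → Idx → Idx → ℤ) (M V : Fin 3 → Fin 3 → Idx → ℤ) :
    jacApply (fun a b c => (X a b c : ℂ)) (castParam M) (castParam V) =
      fun i j k => ((jacApply X M V i j k : ℤ) : ℂ) := by
  funext i j k
  simp [jacApply, castParam]

/-- The base point in `ℂ³⁶`. -/
def basePoint : Param := castParam basePointℤ

/-- The derivative of `Ψ` at `M₀` hits every elementary tensor. -/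
theorem totalDeriv_certDir (i j k : Fin 3) :
    totalDeriv basePoint (castParam (certDir i j k)) =
      fun i' j' k' => if i' = i ∧ j' = j ∧ k' = k then 1 else 0 := by
  rw [totalDeriv_apply, univTensor_eq_cast, basePoint, jacApply_cast, cert]
  funext i' j' k'
  simp only [Int.cast_ite, Int.cast_one, Int.cast_zero]

/-- **The derivative of `Ψ` at `M₀` is surjective.** -/
theorem totalDeriv_surjective : Function.Surjective (totalDeriv basePoint) := by
  intro T
  refine ⟨∑ i, ∑ j, ∑ k, T i j k • castParam (certDir i j k), ?_⟩
  simp only [map_sum, map_smul, totalDeriv_certDir]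
  funext i' j' k'
  simp only [Finset.sum_apply, Pi.smul_apply, smul_eq_mul, mul_ite, mul_one, mul_zero]
  rw [Finset.sum_eq_single i', Finset.sum_eq_single j', Finset.sum_eq_single k']
  · simp
  all_goals first
    | (intro b _ hb; simp [Ne.symm hb])
    | (intro h; exact absurd (Finset.mem_univ _) h)

/-- The derivative of `Ψ` at `M₀` has full range. -/
theorem range_totalDeriv : (totalDeriv basePoint).range = ⊤ :=
  LinearMap.range_eq_top.2 totalDeriv_surjective

/-! ## Density of the image and the main theorem -/

/-- The image of `Ψ` is a neighbourhood of `Ψ(M₀)` (inverse function theorem). -/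
theorem range_restrictMap_mem_nhds : Set.range restrictMap ∈ 𝓝 (restrictMap basePoint) := by
  rw [← (hasStrictFDerivAt_restrictMap basePoint).map_nhds_eq_of_surj range_totalDeriv]
  exact Filter.range_mem_map

/-- A polynomial in the `27` entries vanishing on all restrictions of `U` vanishes identically. -/
theorem eval_eq_zero_of_forall_restrictMap (p : MvPolynomial (Fin 3 × Fin 3 × Fin 3) ℂ)
    (hp : ∀ M : Param, MvPolynomial.eval (tensorEntries (restrictMap M)) p = 0)
    (T : Fin 3 → Fin 3 → Fin 3 → ℂ) : MvPolynomial.eval (tensorEntries T) p = 0 := by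
  let L : (Fin 3 → Fin 3 → Fin 3 → ℂ) →ₗ[ℂ] (Fin 3 × Fin 3 × Fin 3 → ℂ) :=
    { toFun := tensorEntries, map_add' := fun _ _ => rfl, map_smul' := fun _ _ => rfl }
  have han : AnalyticOnNhd ℂ (fun S : Fin 3 → Fin 3 → Fin 3 → ℂ => MvPolynomial.eval (L S) p)
      Set.univ := AnalyticOnNhd.eval_linearMap L p
  have hev : (fun S : Fin 3 → Fin 3 → Fin 3 → ℂ => MvPolynomial.eval (L S) p)
      =ᶠ[𝓝 (restrictMap basePoint)] 0 := by
    filter_upwards [range_restrictMap_mem_nhds] with S hS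
    obtain ⟨M, rfl⟩ := hS
    exact hp M
  have h := han.eqOn_zero_of_preconnected_of_eventuallyEq_zero isPreconnected_univ
    (Set.mem_univ _) hev
  exact h (Set.mem_univ T)

/-- **Theorem V (universality of `T_{cw,2} ⊕ ⟨1⟩`).** Every tensor in `ℂ³ ⊗ ℂ³ ⊗ ℂ³` has
asymptotic rank at most `R̃(T_{cw,2} ⊕ ⟨1⟩)`. -/
theorem asymptoticRank_le_univTensor (T : Fin 3 → Fin 3 → Fin 3 → ℂ) :
    asymptoticRank T ≤ asymptoticRank univTensor :=
  chnvz_zariskiClosed_asymptoticRank_le_holds ℂ (Fin 3) (Fin 3) (Fin 3) (asymptoticRank univTensor) T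
    fun p hp => eval_eq_zero_of_forall_restrictMap p
      (fun M => hp _ (asymptoticRank_restrictMap_le M)) T

/-- **Every `3 × 3 × 3` tensor has `R̃ ≤ R̃(T_{cw,2}) + 1`.** -/
theorem asymptoticRank_le_cwTwo_add_one (T : Fin 3 → Fin 3 → Fin 3 → ℂ) :
    asymptoticRank T ≤ asymptoticRank (cwTensor ℂ 2) + 1 :=
  (asymptoticRank_le_univTensor T).trans asymptoticRank_univTensor_le

/-- The sandwich `R̃(T_{cw,2}) ≤ sup_{3×3×3} R̃ ≤ R̃(T_{cw,2}) + 1`: the maximal asymptotic rank on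
`ℂ³ ⊗ ℂ³ ⊗ ℂ³` is attained within one unit at `T_{cw,2}` itself. -/
theorem cwTwo_sandwich :
    (∀ T : Fin 3 → Fin 3 → Fin 3 → ℂ, asymptoticRank T ≤ asymptoticRank (cwTensor ℂ 2) + 1) ∧
      ∀ r : ℝ, (∀ T : Fin 3 → Fin 3 → Fin 3 → ℂ, asymptoticRank T ≤ r) →
        asymptoticRank (cwTensor ℂ 2) ≤ r :=
  ⟨asymptoticRank_le_cwTwo_add_one, fun _ h => h _⟩

/-- **Numerically: every `3 × 3 × 3` tensor has `R̃ ≤ 4.9235 < 5`**, from the Alman–Li 2026 bound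
`R̃(T_{cw,2}) ≤ 3.9235` (named fact, reproduced in `SoloInformedCwTwoSpeedup`).
[cite: AlmanLi2026, Theorem 1.3] -/
theorem asymptoticRank_le_of_almanLi (hAL : AlmanLi2026_iteratedSpeedup_cw)
    (T : Fin 3 → Fin 3 → Fin 3 → ℂ) : asymptoticRank T ≤ 4.9235 := by
  have h := asymptoticRank_cwTensor_two_le_of_iteratedSpeedup hAL
  have := asymptoticRank_le_cwTwo_add_one T
  linarith

/-- **Door D1 would bound all of `ℂ³ ⊗ ℂ³ ⊗ ℂ³`:** `R̃(T_{cw,2}) ≤ 3 ⇒ ∀ T, R̃(T) ≤ 4`. -/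
theorem asymptoticRank_le_four_of_door (h : asymptoticRank (cwTensor ℂ 2) ≤ 3)
    (T : Fin 3 → Fin 3 → Fin 3 → ℂ) : asymptoticRank T ≤ 4 := by
  have := asymptoticRank_le_cwTwo_add_one T
  linarith

/-- **The extended asymptotic rank conjecture at `d = 3` (`σ(3) = 1`) implies `ω = 2`**, through
door D1 (`T_{cw,2}` is itself a `3 × 3 × 3` tensor). [cite: ConnerGesmundoLandsbergVentura2022, Thm. 1.1] -/
theorem matrixMultiplication_of_sigma_three
    (h : ∀ T : Fin 3 → Fin 3 → Fin 3 → ℂ, asymptoticRank T ≤ 3) : _root_.MatrixMultiplication :=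
  matrixMultiplication_of_asymptoticRank_cwTensor_two_le_three (h _)

end

end Summit.MatrixMultiplication.MatrixMultiplication.Theorems.CwTwoPlusUnit
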